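import Mathlib.Analysis.SpecialFunctions.Log.Deriv
import Mathlib.Analysis.Calculus.Deriv.MeanValue
import Mathlib.Analysis.Complex.ExponentialBounds
import Mathlib.Analysis.Real.Sqrt
import Mathlib.Topology.Order.IntermediateValue
import Mathlib.MeasureTheory.Integral.IntervalIntegral.FundThmCalculus

/-!
# Gaps / EndDrawdownLinearThresholdConstant — THE CALCULUS BEHIND THE CONJECTURED OCTAL THRESHOLD `C⋆ = √(84∕(77 + 72·log 2))`

GEN 11 of this seat squeezed the threshold constant `C⋆(bOct)` of the octal staircase on the linear (AF-1) road to the KERNEL bracket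
`4∕5 ≤ C⋆ ≤ 9∕10` (`EndDrawdownLinearThresholdRenormSuff.exists_threshold_bOct_decimal`) and recorded, as a float-screened HEURISTIC of the
cell's reading note `g1/THRESHOLD-READING-P3.md` §4, the closed form `C⋆² = 84∕(77 + 72·log 2)`, `C⋆ = 0.813575…`: in the formal limit of
infinitely many Euler substeps per block the scaled backward block map is `w ↦ 4·Φ₇(w)`, `Φ` the flow of `ẇ = C∕√w − 1`; in `v = √w` the
backward flow time from `v₁` down to `v₂` (`C < v₂ < v₁`) is `T_C(v₁) − T_C(v₂)`, `T_C(v) = v² + 2Cv + 2C²·log(v − C)`; a fixed point of the block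
map is an orbit on which `√w` HALVES in time exactly `7` — a root `v > 2C` of `T_C(v) − T_C(v∕2) = 7` — and `T_C(v) − T_C(v∕2) = C²·ψ(v∕C)` with
the PROFILE `ψ(x) = (3∕4)x² + x + 2·log(2(x−1)∕(x−2))` on `x > 2`.
THIS FILE proves the calculus of that last step and nothing else: `ψ′(x) = x²(3x − 7)∕(2(x−1)(x−2))` on `x > 2` (**`hasDerivAt_psi`**,
**`psi_deriv_eq`**); `ψ` strictly decreasing on `(2, 7∕3]`, strictly increasing on `[7∕3, ∞)` (**`psi_strictAntiOn`**, **`psi_strictMonoOn`**), unique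
minimiser `7∕3` (**`psi_min_le`**, **`psi_min_lt`**), `ψ(7∕3) = 77∕12 + 6·log 2` (**`psi_seven_thirds`**); `ψ` takes exactly the values `≥ ψ(7∕3)`
(**`exists_psi_eq_iff`**, with the logarithmic end **`lt_psi_near_two`**); for `C > 0` the halving equation `C²·ψ(x) = 7` has a root `x > 2` iff
`C ≤ cStarConj := √(84∕(77 + 72·log 2))` (**`exists_root_iff`**), TWO roots astride `7∕3` when `C < cStarConj` (**`exists_two_roots`**), the single
tangential root `x = 7∕3` — `√w = (7∕3)·C` — exactly at `C = cStarConj` (**`root_unique_at_cStarConj`**, **`halving_at_tangency_eq_seven_iff`**);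
`T_C′(v) = 2v²∕(v − C)` (**`hasDerivAt_flowTime`**), `∫_{v₂}^{v₁} 2u²∕(u−C) du = T_C(v₁) − T_C(v₂)` (**`integral_eq_flowTime_sub`**), `T_C` falls at unit
rate along every solution of `v̇ = (C − v)∕(2v²)` — the ODE `ẇ = C∕√w − 1` in `v = √w` (**`hasDerivAt_flowTime_comp`**), `T_C(v) − T_C(v∕2) = C²·ψ(v∕C)`
(**`flowTime_sub_half`**), **`exists_halving_iff`**: `(∃ v > 2C, T_C(v) − T_C(v∕2) = 7) ↔ C ≤ cStarConj`; enclosure **`0.81357 < cStarConj < 0.81358`**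
from `Real.log_two_gt_d9` ∕ `_lt_d9` (**`cStarConj_gt`**, **`cStarConj_lt`**), hence inside GEN 11's kernel bracket `[4∕5, 9∕10]` and its exact-rational
certified bracket `[0.81, 0.816]` (**`cStarConj_mem_kernelBracket`**, **`cStarConj_mem_certifiedBracket`**) — CONSISTENCY, not identification.
WHAT IS NOT HERE (and is NOT claimed): that `C⋆(bOct) = cStarConj` — that needs the flow `Φ` as a function, the saddle-node analysis of `w ↦ 4Φ₇(w)`
and a summable error bound between the `7·8^t` implicit unit steps of block `t` and the flow (reading note §4b; sized L).  This file imports NOTHING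
of the seat's `EndDrawdown*` road and says nothing about `EndPossibleLin`; `psi` ∕ `flowTime` carry Mathlib's junk `log` values off `x > 2` ∕ `v > C`
(never used).  (cell pub-balaban-gaps, seat g1-p3 GEN 12, rows CAP ∕ tail «split ∕ weakening»; own leaf; file 33 of «the one-loop interface of the
END statement»; Mathlib-only imports.)
HONEST FRAMING (cell rule, page 1 of everything): [folklore] one-variable calculus (`Real.log`, monotonicity from the sign of a derivative, the
intermediate value theorem, the fundamental theorem of calculus) about ONE explicit profile function attached to ONE toy sequence of the seat's
END-grade reading; `cStarConj` is the CONJECTURED value of a toy threshold, shown here only to satisfy the identities that define the conjecture;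
0 binders of Bałaban's discharged; 0 coefficients certified; words ∕ odds of rows CAP ∕ tail ∕ (D4) ∕ (D1) UNCHANGED; one finite T⁴; NOT [I] Thm 2,
NOT `BetaPertH`, NOT the continuum limit, NOT Clay.
-/

namespace Summit.QuantumFields.BalabanUV.Gaps.EndDrawdownLinearThresholdConstant

open Real Set

noncomputable section

/-! ## §1 The profile function `ψ` and its derivative -/

/-- The PROFILE of the halving equation: `ψ(x) = (3∕4)·x² + x + 2·log(2(x−1)∕(x−2))`, meaningful on `x > 2`
(`C²·ψ(v∕C)` is the time in which `√w` halves from `v` along the backward flow of `ẇ = C∕√w − 1`, see `flowTime_sub_half`). [folklore] -/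
def psi (x : ℝ) : ℝ := 3 / 4 * x ^ 2 + x + 2 * Real.log (2 * (x - 1) / (x - 2))

/-- On `x > 2` the argument of the logarithm exceeds `1`. [folklore] -/
theorem one_lt_psiArg {x : ℝ} (hx : 2 < x) : 1 < 2 * (x - 1) / (x - 2) := by
  rw [lt_div_iff₀ (by linarith)]; linarith

/-- `ψ′(x) = 3x∕2 + 1 − 2∕((x−1)(x−2))` on `x > 2` (chain rule through `log`). [folklore] -/
theorem hasDerivAt_psi {x : ℝ} (hx : 2 < x) :
    HasDerivAt psi (3 / 2 * x + 1 - 2 / ((x - 1) * (x - 2))) x := by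
  have h1 : x - 1 ≠ 0 := ne_of_gt (by linarith)
  have h2 : x - 2 ≠ 0 := ne_of_gt (by linarith)
  have hg : HasDerivAt (fun y : ℝ => 2 * (y - 1) / (y - 2))
      ((2 * (x - 2) - 2 * (x - 1) * 1) / (x - 2) ^ 2) x := by
    have hn : HasDerivAt (fun y : ℝ => 2 * (y - 1)) 2 x := by
      simpa using ((hasDerivAt_id x).sub_const 1).const_mul 2
    have hd : HasDerivAt (fun y : ℝ => y - 2) 1 x := (hasDerivAt_id x).sub_const 2
    exact hn.div hd h2
  have hlog := hg.log (lt_trans one_pos (one_lt_psiArg hx)).ne'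
  have hpoly : HasDerivAt (fun y : ℝ => 3 / 4 * y ^ 2 + y) (3 / 4 * (2 * x) + 1) x := by
    have ha : HasDerivAt (fun y : ℝ => 3 / 4 * y ^ 2) (3 / 4 * (2 * x)) x := by
      simpa using (hasDerivAt_pow 2 x).const_mul (3 / 4)
    exact ha.add (hasDerivAt_id' x)
  have hsum := hpoly.add (hlog.const_mul 2)
  have hfun : psi = fun y : ℝ => 3 / 4 * y ^ 2 + y + 2 * Real.log (2 * (y - 1) / (y - 2)) := rfl
  rw [hfun]
  refine hsum.congr_deriv ?_
  have h3 : 2 * (x - 1) ≠ 0 := mul_ne_zero two_ne_zero h1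
  field_simp
  ring

/-- `deriv ψ x = x²(3x − 7)∕(2(x−1)(x−2))` on `x > 2` — the closed form of `3x∕2 + 1 − 2∕((x−1)(x−2))`. [folklore] -/
theorem psi_deriv_eq {x : ℝ} (hx : 2 < x) : deriv psi x = x ^ 2 * (3 * x - 7) / (2 * ((x - 1) * (x - 2))) := by
  rw [(hasDerivAt_psi hx).deriv]
  have h1 : x - 1 ≠ 0 := ne_of_gt (by linarith)
  have h2 : x - 2 ≠ 0 := ne_of_gt (by linarith)
  field_simp
  ring

/-- `ψ` is continuous on `(2, ∞)`. [folklore] -/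
theorem continuousOn_psi : ContinuousOn psi (Ioi 2) := fun _ hx =>
  (hasDerivAt_psi hx).continuousAt.continuousWithinAt

/-- The denominator `2(x−1)(x−2)` is positive on `x > 2`. [folklore] -/
theorem psiDen_pos {x : ℝ} (hx : 2 < x) : 0 < 2 * ((x - 1) * (x - 2)) :=
  mul_pos two_pos (mul_pos (by linarith) (by linarith))

/-- The sign of `ψ′` is the sign of `3x − 7`: negative on `(2, 7∕3)`. [folklore] -/
theorem psi_deriv_neg {x : ℝ} (hx : 2 < x) (hx' : x < 7 / 3) : deriv psi x < 0 := by
  rw [psi_deriv_eq hx]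
  exact div_neg_of_neg_of_pos (mul_neg_of_pos_of_neg (by positivity) (by linarith)) (psiDen_pos hx)

/-- The sign of `ψ′` is the sign of `3x − 7`: positive on `(7∕3, ∞)`. [folklore] -/
theorem psi_deriv_pos {x : ℝ} (hx : 7 / 3 < x) : 0 < deriv psi x := by
  rw [psi_deriv_eq (by linarith)]
  exact div_pos (mul_pos (by positivity) (by linarith)) (psiDen_pos (by linarith))

/-- `ψ′(7∕3) = 0`: the critical point. [folklore] -/
theorem psi_deriv_seven_thirds : deriv psi (7 / 3) = 0 := by
  rw [psi_deriv_eq (by norm_num)]; norm_num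

/-! ## §2 Monotonicity and the minimum `ψ(7∕3) = 77∕12 + 6·log 2` -/

/-- `ψ` is strictly decreasing on `(2, 7∕3]`. [folklore] -/
theorem psi_strictAntiOn : StrictAntiOn psi (Ioc 2 (7 / 3)) := by
  refine strictAntiOn_of_deriv_neg (convex_Ioc _ _) (continuousOn_psi.mono Ioc_subset_Ioi_self) fun x hx => ?_
  rw [interior_Ioc] at hx
  exact psi_deriv_neg hx.1 hx.2

/-- `ψ` is strictly increasing on `[7∕3, ∞)`. [folklore] -/
theorem psi_strictMonoOn : StrictMonoOn psi (Ici (7 / 3)) := by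
  refine strictMonoOn_of_deriv_pos (convex_Ici _)
    (continuousOn_psi.mono fun x hx => lt_of_lt_of_le (by norm_num) (mem_Ici.mp hx)) fun x hx => ?_
  rw [interior_Ici] at hx
  exact psi_deriv_pos hx

/-- `x = 7∕3` minimises `ψ` on `(2, ∞)`. [folklore] -/
theorem psi_min_le {x : ℝ} (hx : 2 < x) : psi (7 / 3) ≤ psi x := by
  rcases le_or_gt x (7 / 3) with h | h
  · exact psi_strictAntiOn.antitoneOn ⟨hx, h⟩ ⟨by norm_num, le_rfl⟩ h
  · exact psi_strictMonoOn.monotoneOn (mem_Ici.mpr le_rfl) (mem_Ici.mpr h.le) h.le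

/-- The minimiser is unique: `ψ(7∕3) < ψ(x)` for every other `x > 2`. [folklore] -/
theorem psi_min_lt {x : ℝ} (hx : 2 < x) (hne : x ≠ 7 / 3) : psi (7 / 3) < psi x := by
  rcases lt_or_gt_of_ne hne with h | h
  · exact psi_strictAntiOn ⟨hx, h.le⟩ ⟨by norm_num, le_rfl⟩ h
  · exact psi_strictMonoOn (mem_Ici.mpr le_rfl) (mem_Ici.mpr h.le) h

/-- The minimum value: `ψ(7∕3) = 77∕12 + 6·log 2` (`2(7∕3 − 1)∕(7∕3 − 2) = 8 = 2³`). [folklore] -/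
theorem psi_seven_thirds : psi (7 / 3) = 77 / 12 + 6 * Real.log 2 := by
  have h8 : (2 * ((7 : ℝ) / 3 - 1) / (7 / 3 - 2)) = 2 ^ 3 := by norm_num
  simp only [psi]
  rw [h8, Real.log_pow]
  push_cast
  ring

/-- The minimum value is positive (indeed `> 10`). [folklore] -/
theorem psi_seven_thirds_gt_ten : 10 < psi (7 / 3) := by
  rw [psi_seven_thirds]
  have := Real.log_two_gt_d9
  linarith

/-! ## §3 Growth and the range of `ψ` -/

/-- `ψ(x) > (3∕4)x²` on `x > 2` (the logarithm is positive there). [folklore] -/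
theorem psi_gt_sq {x : ℝ} (hx : 2 < x) : 3 / 4 * x ^ 2 < psi x := by
  have := Real.log_pos (one_lt_psiArg hx)
  simp only [psi]
  linarith

/-- `ψ` is continuous on every `[a, b]` with `a > 2`. [folklore] -/
theorem continuousOn_psi_Icc {a b : ℝ} (ha : 2 < a) : ContinuousOn psi (Icc a b) :=
  continuousOn_psi.mono fun _ hy => lt_of_lt_of_le ha hy.1

/-- Far out the profile exceeds any level: `K < ψ(7∕3 + K)` for `K ≥ 2` (the quadratic end). [folklore] -/
theorem lt_psi_far {K : ℝ} (hK : 2 ≤ K) : K < psi (7 / 3 + K) := by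
  have h1 := psi_gt_sq (show (2 : ℝ) < 7 / 3 + K by linarith)
  nlinarith

/-- Near `x = 2` the profile exceeds any level `K > 10` at some point of `(2, 7∕3)` (the logarithmic end: at `a = 2 + 2·exp(−K∕2)` the
logarithm alone contributes `≥ K`, and `a < 7∕3` because `exp(−K∕2) < exp(−5) < 1∕6`). [folklore] -/
theorem exists_lt_psi_near_two {K : ℝ} (hK : 10 < K) : ∃ a, 2 < a ∧ a < 7 / 3 ∧ K < psi a := by
  set e := Real.exp (-(K / 2)) with he
  have hepos : 0 < e := Real.exp_pos _
  have he6 : e < 1 / 6 := by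
    have h1 : e < Real.exp (-5) := Real.exp_lt_exp.mpr (by linarith)
    have h2 : Real.exp (-5 : ℝ) < 1 / 6 := by
      rw [Real.exp_neg, inv_lt_comm₀ (Real.exp_pos _) (by norm_num)]
      have := Real.add_one_lt_exp (show (5 : ℝ) ≠ 0 by norm_num)
      norm_num
      linarith
    exact lt_trans h1 h2
  refine ⟨2 + 2 * e, by linarith, by linarith, ?_⟩
  have harg : 2 * (2 + 2 * e - 1) / (2 + 2 * e - 2) = (1 + 2 * e) / e := by
    rw [div_eq_div_iff (ne_of_gt (by linarith)) hepos.ne']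
    ring
  have hlog : K ≤ 2 * Real.log ((1 + 2 * e) / e) := by
    have h1 : Real.exp (K / 2) ≤ (1 + 2 * e) / e := by
      rw [le_div_iff₀ hepos, he, ← Real.exp_add]
      norm_num
      linarith
    have h2 : K / 2 ≤ Real.log ((1 + 2 * e) / e) := by
      rw [← Real.log_exp (K / 2)]
      exact Real.log_le_log (Real.exp_pos _) h1
    linarith
  have hsq : 0 < 3 / 4 * (2 + 2 * e) ^ 2 + (2 + 2 * e) := by positivity
  simp only [psi]
  rw [harg]
  linarith

/-- `ψ` takes on `(2, ∞)` exactly the values `≥ ψ(7∕3)` (minimum + quadratic end + intermediate value theorem on `[7∕3, 7∕3 + K]`). [folklore] -/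
theorem exists_psi_eq_iff {K : ℝ} : (∃ x, 2 < x ∧ psi x = K) ↔ psi (7 / 3) ≤ K := by
  refine ⟨fun ⟨x, hx, hK⟩ => hK ▸ psi_min_le hx, fun hK => ?_⟩
  have hK2 : 2 ≤ K := by linarith [psi_seven_thirds_gt_ten]
  obtain ⟨x, hxmem, hxK⟩ := intermediate_value_Icc (show (7 : ℝ) / 3 ≤ 7 / 3 + K by linarith)
    (continuousOn_psi_Icc (by norm_num)) ⟨hK, (lt_psi_far hK2).le⟩
  exact ⟨x, lt_of_lt_of_le (by norm_num) hxmem.1, hxK⟩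

/-! ## §4 The conjectured constant `cStarConj = √(84∕(77 + 72·log 2))` -/

/-- The CONJECTURED threshold value of the cell's reading note: `cStarConj := √(84∕(77 + 72·log 2)) = √(7∕ψ(7∕3))`.  A definition of a real
number; NOTHING is claimed here about the seat's threshold `C⋆(bOct)`. [folklore] -/
def cStarConj : ℝ := Real.sqrt (84 / (77 + 72 * Real.log 2))

/-- The denominator is positive. [folklore] -/
theorem denom_pos : 0 < (77 : ℝ) + 72 * Real.log 2 := by
  have := Real.log_two_gt_d9
  linarith

/-- `cStarConj > 0`. [folklore] -/
theorem cStarConj_pos : 0 < cStarConj :=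
  Real.sqrt_pos.mpr (div_pos (by norm_num) denom_pos)

/-- `cStarConj² = 84∕(77 + 72·log 2)`. [folklore] -/
theorem cStarConj_sq : cStarConj ^ 2 = 84 / (77 + 72 * Real.log 2) :=
  Real.sq_sqrt (div_nonneg (by norm_num) denom_pos.le)

/-- The defining identity: `cStarConj² · ψ(7∕3) = 7`. [folklore] -/
theorem cStarConj_sq_mul_psiMin : cStarConj ^ 2 * psi (7 / 3) = 7 := by
  rw [cStarConj_sq, psi_seven_thirds, div_mul_eq_mul_div, div_eq_iff denom_pos.ne']
  ring

/-- `C ≤ cStarConj ↔ C²·ψ(7∕3) ≤ 7` for `C > 0`. [folklore] -/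
theorem le_cStarConj_iff {C : ℝ} (hC : 0 < C) : C ≤ cStarConj ↔ C ^ 2 * psi (7 / 3) ≤ 7 := by
  rw [cStarConj, Real.le_sqrt' hC, psi_seven_thirds, le_div_iff₀ denom_pos]
  constructor <;> intro h <;> linarith

/-- THE ROOT CRITERION: for `C > 0` the halving equation `C²·ψ(x) = 7` has a root `x > 2` iff `C ≤ cStarConj`. [folklore] -/
theorem exists_root_iff {C : ℝ} (hC : 0 < C) : (∃ x, 2 < x ∧ C ^ 2 * psi x = 7) ↔ C ≤ cStarConj := by
  have hC2 : 0 < C ^ 2 := by positivity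
  have key : ∀ x, C ^ 2 * psi x = 7 ↔ psi x = 7 / C ^ 2 := fun x => by
    rw [eq_div_iff hC2.ne', mul_comm]
  simp_rw [key]
  rw [exists_psi_eq_iff, le_div_iff₀ hC2, le_cStarConj_iff hC, mul_comm]

/-- Below the conjectured value there are TWO roots, one on each side of `7∕3` (the two fixed points `w₁ < w₂` of the reading note). [folklore] -/
theorem exists_two_roots {C : ℝ} (hC : 0 < C) (hlt : C < cStarConj) :
    ∃ x₁ x₂, 2 < x₁ ∧ x₁ < 7 / 3 ∧ 7 / 3 < x₂ ∧ C ^ 2 * psi x₁ = 7 ∧ C ^ 2 * psi x₂ = 7 := by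
  have hC2 : 0 < C ^ 2 := by positivity
  set K := 7 / C ^ 2 with hKdef
  have hKmin : psi (7 / 3) < K := by
    rw [hKdef, lt_div_iff₀ hC2, mul_comm]
    have h1 : C ^ 2 < cStarConj ^ 2 := by gcongr
    nlinarith [cStarConj_sq_mul_psiMin, psi_seven_thirds_gt_ten]
  have hK10 : 10 < K := lt_trans psi_seven_thirds_gt_ten hKmin
  have key : ∀ x, psi x = K → C ^ 2 * psi x = 7 := fun x hx => by
    rw [hx, hKdef]; field_simp
  obtain ⟨a, ha2, ha73, hψa⟩ := exists_lt_psi_near_two hK10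
  obtain ⟨x₁, hx₁mem, hx₁K⟩ := intermediate_value_Icc' ha73.le (continuousOn_psi_Icc ha2) ⟨hKmin.le, hψa.le⟩
  have hx₁ne : x₁ ≠ 7 / 3 := fun h => by rw [h] at hx₁K; exact hKmin.ne hx₁K
  obtain ⟨x₂, hx₂mem, hx₂K⟩ := intermediate_value_Icc (show (7 : ℝ) / 3 ≤ 7 / 3 + K by linarith)
    (continuousOn_psi_Icc (by norm_num)) ⟨hKmin.le, (lt_psi_far (by linarith)).le⟩
  have hx₂ne : x₂ ≠ 7 / 3 := fun h => by rw [h] at hx₂K; exact hKmin.ne hx₂K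
  exact ⟨x₁, x₂, lt_of_lt_of_le ha2 hx₁mem.1, lt_of_le_of_ne hx₁mem.2 hx₁ne, lt_of_le_of_ne' hx₂mem.1 hx₂ne,
    key x₁ hx₁K, key x₂ hx₂K⟩

/-- AT the conjectured value the root is unique and sits at the tangency point `x = 7∕3` (i.e. `√w = (7∕3)·C`). [folklore] -/
theorem root_unique_at_cStarConj {x : ℝ} (hx : 2 < x) (hroot : cStarConj ^ 2 * psi x = 7) : x = 7 / 3 := by
  by_contra hne
  have h1 := psi_min_lt hx hne
  have h2 : cStarConj ^ 2 * psi (7 / 3) < cStarConj ^ 2 * psi x := mul_lt_mul_of_pos_left h1 (pow_pos cStarConj_pos 2)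
  rw [cStarConj_sq_mul_psiMin, hroot] at h2
  exact lt_irrefl _ h2

/-! ## §5 Decimal enclosure and consistency with GEN 11's brackets -/

/-- `0.81357 < cStarConj` (from `log 2 < 0.6931471808`). [folklore] -/
theorem cStarConj_gt : (0.81357 : ℝ) < cStarConj := by
  rw [cStarConj, Real.lt_sqrt (by norm_num), lt_div_iff₀ denom_pos]
  have := Real.log_two_lt_d9
  nlinarith

/-- `cStarConj < 0.81358` (from `0.6931471803 < log 2`). [folklore] -/
theorem cStarConj_lt : cStarConj < (0.81358 : ℝ) := by
  rw [cStarConj, Real.sqrt_lt' (by norm_num), div_lt_iff₀ denom_pos]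
  have := Real.log_two_gt_d9
  nlinarith

/-- CONSISTENCY with the KERNEL bracket of GEN 11 (`EndDrawdownLinearThresholdRenormSuff.exists_threshold_bOct_decimal`: `4∕5 ≤ C⋆(bOct) ≤ 9∕10`):
the conjectured value lies strictly inside `[4∕5, 9∕10]`.  Consistency, NOT identification. [folklore] -/
theorem cStarConj_mem_kernelBracket : 4 / 5 < cStarConj ∧ cStarConj < 9 / 10 :=
  ⟨lt_trans (by norm_num) cStarConj_gt, lt_trans cStarConj_lt (by norm_num)⟩

/-- CONSISTENCY with GEN 11's exact-rational certified bracket `[0.81, 0.816]` (kernel criteria + certified arithmetic not replayed in Lean):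
the conjectured value lies strictly inside it.  Consistency, NOT identification. [folklore] -/
theorem cStarConj_mem_certifiedBracket : (0.81 : ℝ) < cStarConj ∧ cStarConj < 0.816 :=
  ⟨lt_trans (by norm_num) cStarConj_gt, lt_trans cStarConj_lt (by norm_num)⟩

/-! ## §6 The flow-time function `T_C(v) = v² + 2Cv + 2C²·log(v − C)` and the halving equation -/

/-- The FLOW-TIME function of the reading note: `T_C(v) = v² + 2Cv + 2C²·log(v − C)` on `v > C`; along the backward flow of `ẇ = C∕√w − 1`
(`v = √w`, `v̇ = (C − v)∕(2v²)`) it decreases at unit rate (`hasDerivAt_flowTime_comp`), so `T_C(v₁) − T_C(v₂)` is the time from `v₁` down to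
`v₂`. [folklore] -/
def flowTime (C v : ℝ) : ℝ := v ^ 2 + 2 * C * v + 2 * C ^ 2 * Real.log (v - C)

/-- `T_C′(v) = 2v + 2C + 2C²∕(v − C) = 2v²∕(v − C)` on `v > C`. [folklore] -/
theorem hasDerivAt_flowTime {C v : ℝ} (hv : C < v) : HasDerivAt (flowTime C) (2 * v ^ 2 / (v - C)) v := by
  have hvC : v - C ≠ 0 := (sub_pos.mpr hv).ne'
  have h1 : HasDerivAt (fun u : ℝ => u ^ 2 + 2 * C * u) (2 * v + 2 * C) v := by
    have ha : HasDerivAt (fun u : ℝ => u ^ 2) (2 * v) v := by simpa using hasDerivAt_pow 2 v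
    have hb : HasDerivAt (fun u : ℝ => 2 * C * u) (2 * C) v := by
      simpa using (hasDerivAt_id v).const_mul (2 * C)
    exact ha.add hb
  have h2 : HasDerivAt (fun u : ℝ => Real.log (u - C)) (1 / (v - C)) v := by
    have := ((hasDerivAt_id v).sub_const C).log hvC
    simpa using this
  have h := h1.add (h2.const_mul (2 * C ^ 2))
  have hfun : flowTime C = fun u : ℝ => u ^ 2 + 2 * C * u + 2 * C ^ 2 * Real.log (u - C) := rfl
  rw [hfun]
  refine h.congr_deriv ?_
  field_simp
  ring

/-- Fundamental theorem of calculus: `∫_{v₂}^{v₁} 2u²∕(u − C) du = T_C(v₁) − T_C(v₂)` for `C < v₂ ≤ v₁` — the integrand is `dt∕(−dv)` along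
`v̇ = (C − v)∕(2v²)`, so the left side is the backward flow time from `v₁` down to `v₂`. [folklore] -/
theorem integral_eq_flowTime_sub {C v₁ v₂ : ℝ} (h₂ : C < v₂) (h₁₂ : v₂ ≤ v₁) :
    ∫ u in v₂..v₁, 2 * u ^ 2 / (u - C) = flowTime C v₁ - flowTime C v₂ := by
  apply intervalIntegral.integral_eq_sub_of_hasDerivAt
  · intro u hu
    rw [uIcc_of_le h₁₂] at hu
    exact hasDerivAt_flowTime (lt_of_lt_of_le h₂ hu.1)
  · apply ContinuousOn.intervalIntegrable
    rw [uIcc_of_le h₁₂]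
    refine ContinuousOn.div (by fun_prop) (by fun_prop) fun u hu => ?_
    exact (sub_pos.mpr (lt_of_lt_of_le h₂ hu.1)).ne'

/-- Along every solution of `v̇ = (C − v)∕(2v²)` in `v > C > 0` (the backward flow of `ẇ = C∕√w − 1` written in `v = √w`) the flow-time
function decreases at unit rate: `d∕dt T_C(v(t)) = −1`. [folklore] -/
theorem hasDerivAt_flowTime_comp {C : ℝ} (hC : 0 < C) {v : ℝ → ℝ} {v' t : ℝ} (hv : HasDerivAt v v' t) (hCv : C < v t)
    (hode : v' = (C - v t) / (2 * v t ^ 2)) : HasDerivAt (fun s => flowTime C (v s)) (-1) t := by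
  have h := (hasDerivAt_flowTime hCv).comp t hv
  refine h.congr_deriv ?_
  have h1 : v t - C ≠ 0 := (sub_pos.mpr hCv).ne'
  have h2 : v t ≠ 0 := (lt_trans hC hCv).ne'
  rw [hode]
  field_simp
  ring

/-- THE HALVING IDENTITY: `T_C(v) − T_C(v∕2) = C²·ψ(v∕C)` for `0 < C`, `2C < v` (so that `v∕2 > C`). [folklore] -/
theorem flowTime_sub_half {C v : ℝ} (hC : 0 < C) (hv : 2 * C < v) :
    flowTime C v - flowTime C (v / 2) = C ^ 2 * psi (v / C) := by
  have h1 : 0 < v - C := by linarith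
  have h2 : 0 < v / 2 - C := by linarith
  have hC0 : C ≠ 0 := hC.ne'
  have harg : 2 * (v / C - 1) / (v / C - 2) = (v - C) / (v / 2 - C) := by
    have hx : 2 < v / C := by rwa [lt_div_iff₀ hC]
    have h3 : v / C - 2 ≠ 0 := (show (0 : ℝ) < v / C - 2 by linarith).ne'
    rw [div_eq_div_iff h3 h2.ne']
    field_simp
  simp only [flowTime, psi]
  rw [harg, Real.log_div h1.ne' h2.ne']
  field_simp
  ring

/-- At the tangency point `v = (7∕3)·C` the halving time is `C²·ψ(7∕3) = C²·(77∕12 + 6·log 2)`. [folklore] -/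
theorem flowTime_halving_at_tangency {C : ℝ} (hC : 0 < C) :
    flowTime C (7 * C / 3) - flowTime C (7 * C / 6) = C ^ 2 * (77 / 12 + 6 * Real.log 2) := by
  have h := flowTime_sub_half hC (show 2 * C < 7 * C / 3 by linarith)
  have h1 : 7 * C / 3 / 2 = 7 * C / 6 := by ring
  have h2 : 7 * C / 3 / C = 7 / 3 := by field_simp
  rw [h1, h2, psi_seven_thirds] at h
  exact h

/-- The tangential halving time equals `7` exactly at `C = cStarConj`. [folklore] -/
theorem halving_at_tangency_eq_seven_iff {C : ℝ} (hC : 0 < C) :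
    flowTime C (7 * C / 3) - flowTime C (7 * C / 6) = 7 ↔ C = cStarConj := by
  rw [flowTime_halving_at_tangency hC, ← psi_seven_thirds]
  have hc2 : 0 < cStarConj ^ 2 := pow_pos cStarConj_pos 2
  have hψ : psi (7 / 3) = 7 / cStarConj ^ 2 := by
    rw [eq_div_iff hc2.ne', mul_comm]
    exact cStarConj_sq_mul_psiMin
  rw [hψ, ← pow_left_inj₀ hC.le cStarConj_pos.le two_ne_zero, mul_div_assoc', div_eq_iff hc2.ne']
  constructor <;> intro h <;> linarith

/-- THE HALVING CRITERION: for `C > 0` there is `v > 2C` on which the flow time from `v` down to `v∕2` equals `7` — under the reading note's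
(unformalised) dictionary, a fixed point of the scaled backward block map `w ↦ 4·Φ₇(w)` — iff `C ≤ cStarConj`. [folklore] -/
theorem exists_halving_iff {C : ℝ} (hC : 0 < C) :
    (∃ v, 2 * C < v ∧ flowTime C v - flowTime C (v / 2) = 7) ↔ C ≤ cStarConj := by
  rw [← exists_root_iff hC]
  constructor
  · rintro ⟨v, hv, h7⟩
    exact ⟨v / C, by rwa [lt_div_iff₀ hC], by rw [← flowTime_sub_half hC hv]; exact h7⟩
  · rintro ⟨x, hx, h7⟩
    refine ⟨C * x, by nlinarith, ?_⟩
    rw [flowTime_sub_half hC (by nlinarith), mul_div_cancel_left₀ x hC.ne']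
    exact h7
/-- `ψ > 0` on `x > 2` — indeed `ψ ≥ ψ(7∕3) > 10` (`psi_min_le`, `psi_seven_thirds_gt_ten`); appended in edition v1.1. [folklore] -/ theorem psi_pos {x : ℝ} (hx : 2 < x) : 0 < psi x := lt_of_lt_of_le (lt_trans (by norm_num) psi_seven_thirds_gt_ten) (psi_min_le hx)
end

end Summit.QuantumFields.BalabanUV.Gaps.EndDrawdownLinearThresholdConstant
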